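import Summits.CriticalPhenomena.PercolationContinuityZ3.Theorems.Transplant.SiteKNFail
import HarnessLib

/-!
# SITE Kozma–Nitzan §4 — the run of the site scheme: the invariant, (29) and (31)

builds on p205010 (kernel theorem, internal audit signed; external expert review pending).
Lane `prim-bschramm`, class C1a (site percolation on `ℤ³`); block (γ) of the SITE same-`p` witness
(`SiteSameP.SiteSamePWitnessZd`, socket p217536), prim-hp-8 lineage.  Site twin of the run half of
`L/KozmaNitzanTheorem6.lean` (`KSch.scheme_next` … `KSch.not_mem_Ewv_zero_of_mem_V`).  Helper file (`--supports stmt-CriticalPhenomena-4575`).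

Along the run of the site scheme on a configuration `ω` of the star carrier (vertex states `starRead ω`):
* `RunInv` — the recorded open vertices are the open explored vertices (with `Q_0` recorded open); the explored region
  consists of `Q_0` and the new regions of the probes made; the cube of every determined macro-vertex is explored ((29));
* `V_subset_Cover`, `det_of_cen_mem_V` — (29); `mem_Stub_of_mem_V_of_mem_Efar`, `not_mem_Ewv_zero_of_mem_V` — (31);
((32), validity and lawfulness are in `SiteKNValid.lean`.)
[cite: KozmaNitzan2024, §4 pp. 25–31 ((29), (31), (32), Definition of an exploration process)]
-/

noncomputable section

namespace Summit.CriticalPhenomena.PercolationContinuityZ3.Theorems.Transplant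

namespace SiteKN

open MeasureTheory ProbabilityTheory
open Literature.Probability.Percolation Literature.Probability.LatticeModels
open Literature.Probability.Percolation.KozmaNitzan Literature.Probability.Percolation.KozmaNitzan.Cells
open GadgetSystem ProbeHistory Contour HSiteScheme
open SiteTransplant (siteConn mem_siteConn)
open SiteStar (starEdge starRead starEdge_injective mem_starRead top_adj_none_some)
open scoped Classical

variable {d : ℕ}

namespace SKSch

variable (S : SKSch d)
/-! ## Unfolding the scheme -/

/-- The history of the run after `n` steps. [folklore] -/
abbrev hst (ω : BondConfig (Option (Site d))) (n : ℕ) : ProbeHistory (Option (Site d)) := S.scheme.E.hist n ω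

/-- **The three cases of a step**: no probe, or a valid history with a chosen edge, examined by the probe. [folklore] -/
theorem next_cases (ω : BondConfig (Option (Site d))) (n : ℕ) :
    S.scheme.E.next (S.hst ω n) = none ∨
      ∃ e, (S.scheme.stN n ω).choice = some e ∧ S.Valid (S.hst ω n) e ∧
        S.scheme.E.next (S.hst ω n) = some (S.probe (S.hst ω n) e) := by
  cases hP : S.nextProbe (S.hst ω n) with
  | none => exact Or.inl hP
  | some P =>
    obtain ⟨e, hc, hV, rfl⟩ := S.nextProbe_eq_some hP
    exact Or.inr ⟨e, hc, hV, hP⟩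

/-- If a probe is made then it is the examination of the chosen edge after a valid history. [folklore] -/
theorem of_next_some {ω : BondConfig (Option (Site d))} {n : ℕ} {P : AProbe (Option (Site d))}
    (hP : S.scheme.E.next (S.hst ω n) = some P) :
    ∃ e, (S.scheme.stN n ω).choice = some e ∧ S.Valid (S.hst ω n) e ∧ P = S.probe (S.hst ω n) e :=
  S.nextProbe_eq_some hP
/-! ## The evolution of `V`, `ξ` -/

/-- `Q_0 ⊆ V`. [folklore] -/
theorem U₀V_subset_V (h : ProbeHistory (Option (Site d))) : S.U₀V ⊆ S.V h := Finset.subset_union_left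

/-- A `none` step leaves `V` and `ξ` unchanged. [folklore] -/
theorem V_ξ_cons_none (h : ProbeHistory (Option (Site d))) : S.V (none :: h) = S.V h ∧ S.ξ (none :: h) = S.ξ h := by
  unfold V ξ; rw [supp_cons_none, opens_cons_none]; exact ⟨rfl, rfl⟩

/-- A probe adds its examined vertices to `V`. [folklore] -/
theorem V_cons_some (r : ProbeRecord (Option (Site d))) (h : ProbeHistory (Option (Site d))) :
    S.V (some r :: h) = S.V h ∪ unstar r.1 := by
  unfold V; rw [supp_cons_some]
  ext x; simp only [Finset.mem_union, mem_unstar]; tauto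

/-- A probe adds its observed open vertices to `ξ`. [folklore] -/
theorem ξ_cons_some (r : ProbeRecord (Option (Site d))) (h : ProbeHistory (Option (Site d))) :
    S.ξ (some r :: h) = S.ξ h ∪ unstar r.2 := by
  unfold ξ; rw [opens_cons_some]
  ext x; simp only [Finset.mem_union, mem_unstar]; tauto

/-- `V` only grows along a history. [folklore] -/
theorem V_subset_cons (s : Option (ProbeRecord (Option (Site d)))) (h : ProbeHistory (Option (Site d))) :
    S.V h ⊆ S.V (s :: h) :=
  Finset.union_subset_union le_rfl (unstar_mono (supp_subset_cons s h))

/-- `V` only grows along the run. [folklore] -/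
theorem V_mono_run (ω : BondConfig (Option (Site d))) {m n : ℕ} (hmn : m ≤ n) : S.V (S.hst ω m) ⊆ S.V (S.hst ω n) := by
  have : Monotone fun n => S.V (S.hst ω n) := by
    refine monotone_nat_of_le_succ fun n => ?_
    show S.V (S.hst ω n) ⊆ S.V (S.hst ω (n + 1))
    exact S.V_subset_cons _ _
  exact this hmn

/-- No probe: `V`, `ξ` and the macro-state are unchanged. [folklore] -/
theorem step_none {ω : BondConfig (Option (Site d))} {n : ℕ} (hD : S.scheme.E.next (S.hst ω n) = none) :
    S.V (S.hst ω (n + 1)) = S.V (S.hst ω n) ∧ S.ξ (S.hst ω (n + 1)) = S.ξ (S.hst ω n) ∧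
      S.scheme.stN (n + 1) ω = S.scheme.stN n ω := by
  have h1 : S.hst ω (n + 1) = none :: S.hst ω n := by
    show S.scheme.E.hist (n + 1) ω = _
    rw [AExplorer.hist_succ, S.scheme.E.step_of_none hD]
  rw [h1, (S.V_ξ_cons_none _).1, (S.V_ξ_cons_none _).2]
  exact ⟨rfl, rfl, S.scheme.stN_succ_of_next_none hD⟩

/-- A probe along `e`: `V` gains the new region, `ξ` the observed open revealed vertices, and the macro-state is updated
by the success of the examination. [cite: KozmaNitzan2024, §4 p. 27 (E_{i+1}, G_{i+1}, X_{i+1})] -/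
theorem step_some {ω : BondConfig (Option (Site d))} {n : ℕ} {e : Site 2 × MDir} (hc : (S.scheme.stN n ω).choice = some e)
    (hD : S.scheme.E.next (S.hst ω n) = some (S.probe (S.hst ω n) e)) :
    S.V (S.hst ω (n + 1)) = S.V (S.hst ω n) ∪ S.newRegion (S.hst ω n) e (obsV (starRead ω) (S.envV (S.hst ω n) e)) ∧
      S.ξ (S.hst ω (n + 1)) = S.ξ (S.hst ω n) ∪
        obsV (starRead ω) (S.revealV (S.hst ω n) e (obsV (starRead ω) (S.envV (S.hst ω n) e))) ∧
      S.scheme.stN (n + 1) ω = (S.scheme.stN n ω).update e (S.succ (S.hst ω n) e ((S.probe (S.hst ω n) e).read ω)) := by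
  have h1 : S.hst ω (n + 1) = some ((S.probe (S.hst ω n) e).record ω) :: S.hst ω n := by
    show S.scheme.E.hist (n + 1) ω = _
    rw [AExplorer.hist_succ, S.scheme.E.step_of_some hD]
  have hrev : ((S.probe (S.hst ω n) e).record ω).1 =
      stars (S.revealV (S.hst ω n) e (obsV (starRead ω) (S.envV (S.hst ω n) e))) := by
    show stars (S.revealV (S.hst ω n) e (unstar (obs ω (stars (S.envV (S.hst ω n) e))))) = _
    rw [unstar_obs_stars]
  refine ⟨?_, ?_, ?_⟩
  · rw [h1, V_cons_some, hrev, unstar_stars, revealV, Finset.union_sdiff_self_eq_union]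
  · rw [h1, ξ_cons_some]
    congr 1
    show unstar (obs ω ((S.probe (S.hst ω n) e).reveal ω)) = _
    change unstar (obs ω (stars (S.revealV (S.hst ω n) e (unstar (obs ω (stars (S.envV (S.hst ω n) e))))))) = _
    rw [unstar_obs_stars, unstar_obs_stars]
  · rw [S.scheme.stN_succ_of_next_some hD, hc]
    rfl

/-- `V` of the empty history is `Q_0`. [cite: KozmaNitzan2024, §4 p. 27 (E₁ = Q_{(0,0)})] -/
theorem V_nil : S.V [] = S.U₀V := by
  unfold V U₀V; rw [supp_nil]; simp [unstar]
/-! ## The run invariant -/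

/-- **The invariant of the run after `n` steps**: the recorded open vertices are the open explored vertices, with `Q_0`
recorded open; the explored region consists of `Q_0` and the new regions of the probes made; the cube of every
determined macro-vertex is explored ((29)). [cite: KozmaNitzan2024, §4 pp. 26–27 ((29), E_{i+1})] -/
structure RunInv (ω : BondConfig (Option (Site d))) (n : ℕ) : Prop where
  /-- the record -/
  ξ_iff : ∀ x, x ∈ S.ξ (S.hst ω n) ↔ x ∈ S.V (S.hst ω n) ∧ (x ∈ starRead ω ∨ x ∈ S.U₀V)
  /-- the explored region -/
  V_cases : ∀ y ∈ S.V (S.hst ω n), y ∈ S.C.Q 0 ∨ ∃ m < n, ∃ e, (S.scheme.stN m ω).choice = some e ∧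
    S.Valid (S.hst ω m) e ∧ S.scheme.E.next (S.hst ω m) = some (S.probe (S.hst ω m) e) ∧
    y ∈ S.newRegion (S.hst ω m) e (obsV (starRead ω) (S.envV (S.hst ω m) e))
  /-- (29) -/
  det_Q : ∀ x, (S.scheme.stN n ω).Det x → S.C.Q x ⊆ S.V (S.hst ω n)

/-- **The invariant holds along the run.** [cite: KozmaNitzan2024, §4 pp. 26–27] -/
theorem runInv (ω : BondConfig (Option (Site d))) (n : ℕ) : S.RunInv ω n := by
  induction n with
  | zero =>
    have hV : S.V (S.hst ω 0) = S.C.Q 0 := S.V_nil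
    refine ⟨?_, ?_, ?_⟩
    · intro x
      have hξ : S.ξ (S.hst ω 0) = S.U₀V := by
        show S.ξ [] = S.U₀V
        unfold ξ; rw [opens_nil]; simp [unstar]
      rw [hξ, hV]
      exact ⟨fun h => ⟨h, Or.inr h⟩, fun h => h.2.elim (fun _ => h.1) id⟩
    · intro y hy; rw [hV] at hy; exact Or.inl hy
    · intro x hx
      have hx' : x = 0 := by
        rcases hx with hx | hx
        · simpa [HSiteScheme.stN, HSiteScheme.mst, HState.start] using hx
        · simp [HSiteScheme.stN, HSiteScheme.mst, HState.start] at hx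
      rw [hx', hV]
  | succ n hI =>
    rcases S.next_cases ω n with hD | ⟨e, hc, hV, hD⟩
    · obtain ⟨hVV, hξ, hst⟩ := S.step_none hD
      refine ⟨?_, ?_, ?_⟩
      · intro x; rw [hξ, hVV]; exact hI.ξ_iff x
      · intro y hy
        rw [hVV] at hy
        rcases hI.V_cases y hy with h | ⟨m, hm, rest⟩
        · exact Or.inl h
        · exact Or.inr ⟨m, by omega, rest⟩
      · intro x hx
        rw [hst] at hx; rw [hVV]; exact hI.det_Q x hx
    · obtain ⟨hV2, hξ1, hst⟩ := S.step_some hc hD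
      refine ⟨?_, ?_, ?_⟩
      · intro x
        rw [hξ1, hV2, Finset.mem_union, Finset.mem_union, mem_obsV_iff, hI.ξ_iff x, revealV, Finset.mem_sdiff]
        constructor
        · rintro (⟨hxV, h'⟩ | ⟨⟨hxr, -⟩, hxω⟩)
          · exact ⟨Or.inl hxV, h'⟩
          · exact ⟨Or.inr hxr, Or.inl hxω⟩
        · rintro ⟨hxV | hxr, h'⟩
          · exact Or.inl ⟨hxV, h'⟩
          · by_cases hxV : x ∈ S.V (S.hst ω n)
            · exact Or.inl ⟨hxV, h'⟩
            · rcases h' with h' | h'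
              · exact Or.inr ⟨⟨hxr, hxV⟩, h'⟩
              · exact absurd (S.U₀V_subset_V _ h') hxV
      · intro y hy
        rw [hV2] at hy
        rcases Finset.mem_union.1 hy with hy | hy
        · rcases hI.V_cases y hy with h | ⟨m, hm, rest⟩
          · exact Or.inl h
          · exact Or.inr ⟨m, by omega, rest⟩
        · exact Or.inr ⟨n, Nat.lt_succ_self n, e, hc, hV, hD, hy⟩
      · intro x hx
        rw [hst] at hx
        rw [hV2]
        rcases (HState.det_update_iff _ _ _).1 hx with rfl | hx
        · intro y hy
          exact Finset.mem_union_right _ (Finset.mem_union_left _ (Finset.mem_union_right _ hy))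
        · exact (hI.det_Q x hx).trans Finset.subset_union_left
/-! ## Consequences of the invariant -/

section Consequences

variable {S}
variable {ω : BondConfig (Option (Site d))}

/-- `0 ∈ E_n` and the origin of the macro-lattice is occupied, along the whole run. [folklore] -/
theorem zero_mem_run (n : ℕ) : (0 : Site d) ∈ S.V (S.hst ω n) ∧ (0 : Site 2) ∈ (S.scheme.stN n ω).occ := by
  refine ⟨S.U₀V_subset_V _ ?_, (S.scheme.inv_mst _).zero_mem⟩
  show (0 : Site d) ∈ S.C.Q 0
  rw [Cells.Q, ← S.C.cen_zero]
  exact center_mem_cIcc _ _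

/-- A determined macro-vertex has its cube, hence its centre, explored ((29)). [cite: KozmaNitzan2024, §4 p. 26 ((29))] -/
theorem Q_subset_V_of_det {n : ℕ} {x : Site 2} (hx : (S.scheme.stN n ω).Det x) : S.C.Q x ⊆ S.V (S.hst ω n) :=
  (S.runInv ω n).det_Q x hx

/-- The new region of a probe lies in the explored region afterwards. [cite: KozmaNitzan2024, §4 p. 27 (E_{i+1})] -/
theorem newRegion_subset_V {m n : ℕ} (hmn : m < n) {e : Site 2 × MDir} (hc : (S.scheme.stN m ω).choice = some e)
    (hD : S.scheme.E.next (S.hst ω m) = some (S.probe (S.hst ω m) e)) :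
    S.newRegion (S.hst ω m) e (obsV (starRead ω) (S.envV (S.hst ω m) e)) ⊆ S.V (S.hst ω n) := by
  have h1 := (S.step_some hc hD).1
  intro y hy
  refine S.V_mono_run ω (Nat.succ_le_of_lt hmn) ?_
  show y ∈ S.V (S.hst ω (m + 1))
  rw [h1]; exact Finset.mem_union_right _ hy

/-- The target of a probe is determined afterwards. [folklore] -/
theorem det_tgt_of_probe {m n : ℕ} (hmn : m < n) {e : Site 2 × MDir} (hc : (S.scheme.stN m ω).choice = some e)
    (hD : S.scheme.E.next (S.hst ω m) = some (S.probe (S.hst ω m) e)) :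
    tgt e ∈ (S.scheme.stN n ω).occ ∨ tgt e ∈ (S.scheme.stN n ω).blk := by
  have hst := (S.step_some hc hD).2.2
  refine S.scheme.det_stN_mono ω (Nat.succ_le_of_lt hmn) ?_
  rw [hst]
  exact HState.det_update_tgt _ _ _

/-- **The explored region lies in the cover of the determined macro-vertices.**
[cite: KozmaNitzan2024, §4 pp. 26–27 ((29), (31))] -/
theorem V_subset_Cover (n : ℕ) :
    (↑(S.V (S.hst ω n)) : Set (Site d)) ⊆ S.C.Cover {x | x ∈ (S.scheme.stN n ω).occ ∨ x ∈ (S.scheme.stN n ω).blk} := by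
  intro y hy
  rcases (S.runInv ω n).V_cases y (Finset.mem_coe.1 hy) with h | ⟨m, hm, e, hc, -, hD, h⟩
  · exact S.C.subset_cover (u := 0) (Or.inl (zero_mem_run n).2) (Or.inl (Finset.mem_coe.2 (S.C.Q_subset_Cell _ h)))
  · have hsrc : e.1 ∈ {x | (S.scheme.stN n ω).Det x} :=
      Or.inl (S.scheme.occ_stN_mono ω hm.le (HState.cand_of_choice hc).1)
    have htgt : tgt e ∈ {x | (S.scheme.stN n ω).Det x} := det_tgt_of_probe hm hc hD
    rcases Finset.mem_union.1 h with h | h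
    · rcases Finset.mem_union.1 (S.C.Ewv_subset_Cells _ _ h) with h | h
      · exact S.C.subset_cover hsrc (Or.inl (Finset.mem_coe.2 h))
      · exact S.C.subset_cover htgt (Or.inl (Finset.mem_coe.2 h))
    · obtain ⟨du, -, h⟩ := Finset.mem_biUnion.1 h
      have hj : S.jOf (S.hst ω m) e du (obsV (starRead ω) (S.envV (S.hst ω m) e)) + 1 ≤ S.C.K := S.jOf_lt _ _ _ _
      rcases Finset.mem_union.1 (S.C.Stub_subset_Cell_union_Zone _ _ hj h) with h | h
      · exact S.C.subset_cover htgt (Or.inl (Finset.mem_coe.2 h))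
      · exact S.C.subset_cover htgt (Or.inr (Set.mem_iUnion.2 ⟨du, Finset.mem_coe.2 h⟩))

/-- **(29), converse half**: a macro-vertex whose centre is explored is determined. [cite: KozmaNitzan2024, §4 p. 26 ((29))] -/
theorem det_of_cen_mem_V {n : ℕ} {x : Site 2} (hx : S.C.cen x ∈ S.V (S.hst ω n)) :
    x ∈ (S.scheme.stN n ω).occ ∨ x ∈ (S.scheme.stN n ω).blk :=
  S.C.mem_of_cen_mem_Cover (V_subset_Cover n (Finset.mem_coe.2 hx))

/-- A probe's target is examined only once. [folklore] -/
theorem probe_time_unique {m m' : ℕ} {e e' : Site 2 × MDir} (hc : (S.scheme.stN m ω).choice = some e)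
    (hD : S.scheme.E.next (S.hst ω m) = some (S.probe (S.hst ω m) e)) (hc' : (S.scheme.stN m' ω).choice = some e')
    (hD' : S.scheme.E.next (S.hst ω m') = some (S.probe (S.hst ω m') e')) (ht : tgt e' = tgt e) : m = m' := by
  by_contra hne
  rcases lt_or_gt_of_ne (Ne.symm hne) with hlt | hlt
  · have h1 := det_tgt_of_probe hlt hc' hD'
    rw [ht] at h1
    exact (HState.cand_of_choice hc).2 h1
  · have h1 := det_tgt_of_probe hlt hc hD
    rw [← ht] at h1
    exact (HState.cand_of_choice hc').2 h1

/-! ## (31): nothing explored later meets `E_{w,v}` -/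

/-- The new region of an examination along `e'` avoids `Btw(w, du) ∪ Q_v`, `v = w + du`, whenever the target of `e'` is
neither `w` nor `v` and its source is not `v`. [cite: KozmaNitzan2024, §4 p. 27 ((31))] -/
theorem newRegion_disjoint (h : ProbeHistory (Option (Site d))) (e' : Site 2 × MDir) (o : Finset (Site d))
    {w : Site 2} {du : MDir} (hv' : tgt e' ≠ w + stepVec du) (hv'w : tgt e' ≠ w) (hw' : e'.1 ≠ w + stepVec du)
    {y : Site d} (hy : y ∈ S.newRegion h e' o) : y ∉ S.C.Q (w + stepVec du) ∧ y ∉ S.C.Btw w du := by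
  rw [and_comm]
  have hQt : ∀ {z}, z ∈ S.C.Q (tgt e') → z ∉ S.C.Btw w du ∧ z ∉ S.C.Q (w + stepVec du) := fun hz =>
    ⟨Finset.disjoint_left.1 (S.C.Q_disjoint_Btw (tgt e') w du) hz, Finset.disjoint_left.1 (S.C.Q_disjoint_Q hv') hz⟩
  rcases Finset.mem_union.1 hy with hy | hy
  · rcases Finset.mem_union.1 hy with hy | hy
    · refine ⟨fun hy' => ?_, Finset.disjoint_right.1 (S.C.Q_disjoint_Btw (w + stepVec du) e'.1 e'.2) hy⟩
      refine Finset.disjoint_left.1 (S.C.Btw_disjoint_Btw (v := w) (δ := du) (v' := e'.1) (δ' := e'.2) ?_ ?_) hy' hy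
      · intro heq
        apply hv'
        have h1 : e'.1 = w := congrArg Prod.fst heq
        have h2 : e'.2 = du := congrArg Prod.snd heq
        show e'.1 + stepVec e'.2 = w + stepVec du
        rw [h1, h2]
      · intro heq; exact hw' (congrArg Prod.fst heq)
    · exact hQt hy
  · obtain ⟨du'', -, hy⟩ := Finset.mem_biUnion.1 hy
    rcases Finset.mem_union.1 (S.C.Stub_subset_Q_union_Btw _ _ (S.jOf_lt _ _ _ _) hy) with hy | hy
    · exact hQt hy
    · refine ⟨fun hy' => ?_, Finset.disjoint_right.1 (S.C.Q_disjoint_Btw (w + stepVec du) (tgt e') du'') hy⟩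
      refine Finset.disjoint_left.1 (S.C.Btw_disjoint_Btw (v := w) (δ := du) (v' := tgt e') (δ' := du'') ?_ ?_) hy' hy
      · intro heq; exact hv'w (congrArg Prod.fst heq)
      · intro heq; exact hv' (congrArg Prod.fst heq)

/-- An undetermined neighbour is an onward direction of every earlier history. [cite: KozmaNitzan2024, §4 p. 27 (X = X_v)] -/
theorem mem_onward_of_not_det {m n : ℕ} (hmn : m ≤ n) {w : Site 2} {du : MDir}
    (hv : ¬(S.scheme.stN n ω).Det (w + stepVec du)) :
    du ∈ Finset.univ.filter fun du => S.C.cen (w + stepVec du) ∉ S.V (S.hst ω m) :=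
  Finset.mem_filter.2 ⟨Finset.mem_univ _, fun h => hv (S.scheme.det_stN_mono ω hmn (det_of_cen_mem_V h))⟩

/-- **(31)**: after the examination of `w` at time `m`, as long as `v = w + du` is undetermined, the explored region meets
`E_{w,v}` only inside the stub `H^{j_x}_{w,v}` revealed at time `m`. [cite: KozmaNitzan2024, §4 p. 27 ((31))] -/
theorem mem_Stub_of_mem_V_of_mem_Efar {n m : ℕ} (hm : m < n) {e : Site 2 × MDir}
    (hc : (S.scheme.stN m ω).choice = some e) (hV : S.Valid (S.hst ω m) e)
    (hD : S.scheme.E.next (S.hst ω m) = some (S.probe (S.hst ω m) e)) {du : MDir}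
    (hv : ¬(S.scheme.stN n ω).Det (tgt e + stepVec du)) {y : Site d} (hyV : y ∈ S.V (S.hst ω n))
    (hyE : y ∈ S.C.Efar (tgt e) du) :
    y ∈ S.C.Stub (tgt e) du (S.jOf (S.hst ω m) e du (obsV (starRead ω) (S.envV (S.hst ω m) e))) := by
  have hdu : du ∈ S.onward (S.hst ω m) (tgt e) := mem_onward_of_not_det hm.le hv
  have hv0 : tgt e + stepVec du ≠ 0 := fun h => hv (by rw [h]; exact Or.inl (zero_mem_run n).2)
  have hyE' := S.C.Efar_subset_Btw_union_Q _ _ hyE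
  rcases (S.runInv ω n).V_cases y hyV with hy0 | ⟨m', hm', e', hc', hV', hD', hy'⟩
  · exfalso
    rcases Finset.mem_union.1 hyE' with h | h
    · exact Finset.disjoint_left.1 (S.C.Q_disjoint_Btw 0 (tgt e) du) hy0 h
    · exact Finset.disjoint_left.1 (S.C.Q_disjoint_Q hv0.symm) hy0 h
  · by_cases hmm : m' = m
    · subst hmm
      rw [hc] at hc'
      cases Option.some_injective _ hc'
      rcases Finset.mem_union.1 hy' with hy' | hy'
      · exact absurd hy' (Valid.not_mem_Ewv_of_mem_Efar hV hdu hyE)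
      · obtain ⟨du'', -, hy'⟩ := Finset.mem_biUnion.1 hy'
        by_cases hdd : du'' = du
        · subst hdd; exact hy'
        · exfalso
          rcases Finset.mem_union.1 (S.C.Stub_subset_Q_union_Btw _ _ (S.jOf_lt _ _ _ _) hy') with h | h
          · exact S.C.Q_disjoint_Efar h hyE
          · exact (S.C.Btw_sep_Efar hdd).not_mem (Finset.mem_coe.2 h) (Finset.mem_coe.2 hyE)
    · exfalso
      have hv' : tgt e' ≠ tgt e + stepVec du := fun h => hv (h ▸ det_tgt_of_probe hm' hc' hD')
      have hv'w : tgt e' ≠ tgt e := fun h => hmm (probe_time_unique hc hD hc' hD' h).symm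
      have hw' : e'.1 ≠ tgt e + stepVec du := fun h =>
        hv (h ▸ Or.inl (S.scheme.occ_stN_mono ω hm'.le (HState.cand_of_choice hc').1))
      obtain ⟨h2, h1⟩ := S.newRegion_disjoint _ _ _ hv' hv'w hw' hy'
      rcases Finset.mem_union.1 hyE' with h | h
      · exact h1 h
      · exact h2 h

/-- **(31) at the origin**: if the explored region meets `E_{0,v}` then `v = 0 + du` is determined (contrapositive: as long as
`v` is undetermined, the explored region avoids `E_{0,v}`).
[cite: KozmaNitzan2024, §4 p. 28 ((E₁ ∪ E_{w,v}) ∩ E_i = E₁)] -/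
theorem det_of_mem_V_of_mem_Ewv_zero {n : ℕ} {du : MDir} {y : Site d} (hyV : y ∈ S.V (S.hst ω n)) (hyE : y ∈ S.C.Ewv 0 du) :
    ((0 : Site 2) + stepVec du) ∈ (S.scheme.stN n ω).occ ∨ ((0 : Site 2) + stepVec du) ∈ (S.scheme.stN n ω).blk := by
  by_contra hv
  have hv0 : (0 : Site 2) + stepVec du ≠ 0 := fun h => hv (by rw [h]; exact Or.inl (zero_mem_run n).2)
  rcases (S.runInv ω n).V_cases y hyV with hy0 | ⟨m', hm', e', hc', -, hD', hy'⟩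
  · rcases Finset.mem_union.1 hyE with h | h
    · exact Finset.disjoint_left.1 (S.C.Q_disjoint_Btw 0 0 du) hy0 h
    · exact Finset.disjoint_left.1 (S.C.Q_disjoint_Q hv0.symm) hy0 h
  · have hv' : tgt e' ≠ 0 + stepVec du := fun h => hv (h ▸ det_tgt_of_probe hm' hc' hD')
    have hv'w : tgt e' ≠ 0 := fun h => (HState.cand_of_choice hc').2 (h ▸ Or.inl (zero_mem_run m').2)
    have hw' : e'.1 ≠ 0 + stepVec du := fun h =>
      hv (h ▸ Or.inl (S.scheme.occ_stN_mono ω hm'.le (HState.cand_of_choice hc').1))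
    obtain ⟨h2, h1⟩ := S.newRegion_disjoint _ _ _ hv' hv'w hw' hy'
    rcases Finset.mem_union.1 hyE with h | h
    · exact h1 h
    · exact h2 h

end Consequences

end SKSch

end SiteKN

end Summit.CriticalPhenomena.PercolationContinuityZ3.Theorems.Transplant

end
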